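import Summits.QuantumFields.YangMills.Theorems.UnitScaleTiltProp7DivergenceSupDoorQ
import Summits.QuantumFields.YangMills.Theorems.UnitScaleTiltProp7LODDivergenceAgmonRow
import Summits.QuantumFields.YangMills.Theorems.UnitScaleTiltProp7PenaltySupLetter
import HarnessLib

/-!
# Route `UnitScaleTilt`, crux K1 «MinimiserStabilityRegPr» (stmt-QuantumFields-19200), EX row (5) `h3` (STOREY H), C6 ∕ F3 PIN TABLE — (F) THE `hUsup` KNIT:
# **THE SUP OF THE LOD RESOLVENT ON DIVERGENCE DATA, `u = G_a(D*_{U₀}x)`, AT A PRINTED-REGULAR BACKGROUND** — DOOR-Q ✓`Prop7DivergenceSupDoorQ.sup_le_of_hHlocV_q` (px5 g16) fed with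
# `q := a•T(ι(Q″u))`: the relative penalty letter ✓`Prop7PenaltySupLetter.hPen_of_regPr` (px13 g17), the divergence-form Agmon `L²` row ✓`Prop7LODDivergenceAgmonRow.sq_sum_ball_G_DstarL2_le_kfree`
# (px21 g17, (β-L²)) and the equation `hAG`.  (★CHAIR WORD №63 (2) «`hUsup` supplier road (β): ONE mechanism, two instances»; cst-p1 g38 18:01:57Z; px21 g17 18:22:39Z socket fit.)

Cell `ym3-torus` (HUMAN RULING D-0037; rung R3 = SU(2) YM₃ on T³ — NOT d = 4, NOT infinite volume, NOT a mass gap, NOT Clay).  Width seat `ym3-torus-px5` (gen 16);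
`--supports stmt-QuantumFields-19200 --as helper`; count-neutral; THEOREMS ONLY (0 `def`, 0 `sorry`, default heartbeats).

WHAT IS PROVED (ns `Summit.QuantumFields.YangMills.Theorems.Prop7LODDivergenceSupKnit`; FILE C's ∕ px21's LOD letter block VERBATIM: `F {n K} (h : n ≤ K) {c₀ c₁} {ε₀} (hε₀) (hε7) U₀ (hreg)
Q″ (hseq) ι (hι) T (hT) {a} (ha) G (hAG)`): ★★★ **`sup_G_DstarL2_le`** — with the consumer's free reals `Ch θ₀` of the curved interior η-½-Hölder letter `hH` (px19 g16 text 857ccd79b0071bdc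
VERBATIM; a TREE THEOREM in ∃-form: ✓`Prop7CurvedMemberLocalHolder.exists_hHlocV`), the cap `ε₀ ≤ θ₀∕48`, and px21's K-free Combes–Thomas window `(μ, δ₁)`: for every `x` with `‖x(b)‖ ≤ X`,
**`‖(G(D*_{U₀}x))(y)‖ ≤ Cu·X`** at every site, `Cu := 2(8Ch(1 + Cpen) + 1)³·√C_A + 1` with `Cpen` = ✓`hPen_of_regPr`'s displayed constant and `C_A` = ✓`sq_sum_ball_G_DstarL2_le_kfree`'s —
px13 g17's frozen letter `hUsup` (`H2LOC-LETTER-hUsup.px13g17.txt` 7916524ae76ffc76) with `Cu` INSTANTIATED (K-free exactly at the pins `c₁ = c₀ℓ³`, where `Cpen = 25a∕8` and `C_P² = max 2 (16∕a)`;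
the knit does not pin — the (M)∕S-level does, as for `CHω`).  CONSUMER: `obtain ⟨Ch, θ₀, hCh, hθ₀, hH⟩ := exists_hHlocV` ONCE (outside all members), then per member `hUsup := sup_G_DstarL2_le … Ch θ₀ hCh hH hεθ …`.
HYP-SAT (★★OWNER RULING №42).  `hH` is inhabited by ✓`exists_hHlocV`; the LOD block is F3's∕FILE C's (R-editions' `Lift` antecedent, ✓`RS_eq_projR_of_lift` lineage); `RegPr` = the EX face's
standing hypothesis; the window is a numeric condition on `(μ, δ₁, a)` at the pins; the conclusion is a real inequality, nothing conclusion-shaped is assumed.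
HONEST SCOPE.  A one-line composition of landed theorems; nothing of (M), `hHωwRow`, `h3`, norm_G, EX, 19200 or the rung is proved; the Yang–Mills mass gap is NOT proved.

References: T. Bałaban, CMP **99** (1985) 389–434 [Balaban1985BackgroundPropagators] (Thm 3.1 (3.42)–(3.47) pp.397–399, p.399 L1–3, (3.24) p.394, (3.49) p.399); CMP **96** (1984)
223–250 [Balaban1984PropagatorsII] (Lemma 2.1 (2.61)–(2.63) p.234); CMP **95** (1984) 17–40 [Balaban1984PropagatorsI] ((1.18) p.20, (1.110) p.35).
-/

set_option autoImplicit false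

noncomputable section

open scoped BigOperators Matrix.Norms.L2Operator InnerProductSpace ComplexConjugate

namespace Summit.QuantumFields.YangMills.Theorems.Prop7LODDivergenceSupKnit

open Literature.MathematicalPhysics.QuantumFieldTheory.Balaban1983to89
open Literature.MathematicalPhysics.QuantumFieldTheory.Balaban1983to89.T3ContinuumYM3Torus
open T4Continuum BlockAveraging
open BlockAveraging (Idx)
open B7Prop1Explicit (disp)
open B5Eq118OneStroke (iterBlockOf)
open B10Eq27TorusAxialLog (holT transl)
open B7TransferAnalyticMean (meanCLM)
open B4Sect5Torus (TSite tdist)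
open B9SectCLatticeCarrier (Bond)
open B9Eq311L2Pairing (WL2)
open B11Eq103H1Complex (SiteL2K BondL2K)
open Summit.QuantumFields.YangMills.Theorems.Prop8Chart (emlIterU)
open T3SectALandauChart (bgUnits)
open T3PrintedRegularMinimiser (RegPr)
open T3PrintedRegularOrbits (sites_eq)
open T3LevelShift (siteShift)
open Summit.QuantumFields.YangMills.Theorems.Prop7SectET3Transport (periodsT3 siteEquiv bgOfCfg)
open Summit.QuantumFields.YangMills.Theorems.Prop7SectET3HilbertLetters (W₂ toL2S DstarL2 covLapSite)
open Summit.QuantumFields.YangMills.Theorems.Prop7DivergenceSupDoorQ (sup_le_of_hHlocV_q)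
open Summit.QuantumFields.YangMills.Theorems.Prop7LODDivergenceAgmonRow (sq_sum_ball_G_DstarL2_le_kfree)
open Summit.QuantumFields.YangMills.Theorems.Prop7PenaltySupLetter (hPen_of_regPr)

section LOD

variable (F : T3Family) {n K : ℕ} (h : n ≤ K) {c₀ c₁ : ℝ} [Fact (0 < c₀)] [Fact (0 < c₁)]
  {ε₀ : ℝ} (hε₀ : 0 < ε₀) (hε7 : 10 ^ 7 * (F.L : ℝ) ^ 3 * ε₀ ≤ 1)
  (U₀ : GaugeField (F.P K) 0 (Matrix.specialUnitaryGroup (Fin 2) ℂ)) (hreg : RegPr F n K ε₀ U₀)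
  (Q'' : SiteL2K ℂ 3 (periodsT3 F K) c₀ W₂ →ₗ[ℂ] (Site (F.P K) (K - n) → Matrix (Fin 2) (Fin 2) ℂ))
  (hseq : ∀ lam : Site (F.P K) 0 → Matrix (Fin 2) (Fin 2) ℂ, ∃ ns : (j : ℕ) → Site (F.P K) j → Matrix (Fin 2) (Fin 2) ℂ, ns 0 = lam ∧
      (∀ (j : ℕ) (y : Site (F.P K) (j + 1)), ns (j + 1) y = ns j (emb y) - meanCLM (Idx (F.P K)) (Matrix (Fin 2) (Fin 2) ℂ) fun i : Idx (F.P K) =>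
        ns j (emb y) - ((holT (emlIterU j (bgUnits F K U₀)) (emb y) (stairWord i.2.1 (off i.1)) : (Matrix (Fin 2) (Fin 2) ℂ)ˣ) : Matrix (Fin 2) (Fin 2) ℂ) *
          ns j (transl (emb y) (disp (stairWord i.2.1 (off i.1)))) * (((holT (emlIterU j (bgUnits F K U₀)) (emb y) (stairWord i.2.1 (off i.1)))⁻¹ : (Matrix (Fin 2) (Fin 2) ℂ)ˣ) : Matrix (Fin 2) (Fin 2) ℂ)) ∧
      ns (K - n) = Q'' (toL2S F K c₀ lam))
  (ι : (Site (F.P K) (K - n) → Matrix (Fin 2) (Fin 2) ℂ) →ₗ[ℂ] SiteL2K ℂ 3 (periodsT3 F n) c₁ W₂)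
  (hι : ∀ c, ι c = toL2S F n c₁ (fun z => c (siteShift (sites_eq F n K h) z)))
  (T : SiteL2K ℂ 3 (periodsT3 F n) c₁ W₂ →ₗ[ℂ] SiteL2K ℂ 3 (periodsT3 F K) c₀ W₂)
  (hT : ∀ (l : SiteL2K ℂ 3 (periodsT3 F K) c₀ W₂) (f : SiteL2K ℂ 3 (periodsT3 F n) c₁ W₂), ⟪ι (Q'' l), f⟫_ℂ = ⟪l, T f⟫_ℂ)
  {a : ℝ} (ha : 0 < a)
  (G : SiteL2K ℂ 3 (periodsT3 F K) c₀ W₂ →ₗ[ℂ] SiteL2K ℂ 3 (periodsT3 F K) c₀ W₂)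
  (hAG : ∀ f, covLapSite F n K c₀ U₀ (G f) + (a : ℂ) • T (ι (Q'' (G f))) = f)

include h hε₀ hε7 hreg hseq hι hT ha hAG in
/-- ★★★ **(F) THE `hUsup` KNIT — THE SUP OF THE LOD RESOLVENT ON DIVERGENCE DATA AT A PRINTED-REGULAR BACKGROUND** ([Balaban1985BackgroundPropagators] Thm 3.1 (3.46)-type, K-free at the pins).
From the curved interior η-½-Hölder letter `hH` (px19 text 857ccd79 VERBATIM; inhabited by ✓`exists_hHlocV`), `ε₀ ≤ θ₀∕48`, and px21's window `(μ, δ₁)`: for `‖x(b)‖ ≤ X` on every bond,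
`‖(G(D*_{U₀}x))(y)‖ ≤ (2(8Ch(1 + Cpen) + 1)³√C_A + 1)·X` at every site — DOOR-Q ✓`sup_le_of_hHlocV_q` at `u := G(D*x)`, `q := a•T(ι(Q″u))` (equation `hAG`), `hq :=` ✓`hPen_of_regPr` at `g := u`,
`hL2 :=` ✓`sq_sum_ball_G_DstarL2_le_kfree`.  This is px13 g17's letter `hUsup` 7916524ae76ffc76 with `Cu` INSTANTIATED.
[cite: Balaban1985BackgroundPropagators, Thm 3.1 (3.46) p.398, p.399 L1-3, (3.24) p.394, (3.49) p.399; Balaban1984PropagatorsII, Lemma 2.1 (2.61)-(2.63) p.234] -/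
theorem sup_G_DstarL2_le (Ch θ₀ : ℝ) (hCh : 0 ≤ Ch)
    (hH : ∀ (F : T3Family) (n K : ℕ) (c₀ : ℝ) [Fact (0 < c₀)] (V : GaugeField (F.P K) 0 (Matrix.specialUnitaryGroup (Fin 2) ℂ))
      (u q : SiteL2K ℂ 3 (periodsT3 F K) c₀ W₂) (f : BondL2K ℂ 3 (periodsT3 F K) c₀ W₂) (x : TSite 3 (periodsT3 F K)) (Mu Mf Mq δ : ℝ),
      0 ≤ Mu → 0 ≤ Mf → 0 ≤ Mq → 0 ≤ δ → (F.L : ℝ) ^ (K - n) * δ ≤ θ₀ →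
      covLapSite F n K c₀ V u + q = DstarL2 F n K c₀ V f →
      (∀ y, tdist (periodsT3 F K) x y ≤ 4 * (F.L : ℝ) ^ (K - n) + 1 → ‖WL2.equiv ℂ (fun _ : TSite 3 (periodsT3 F K) => c₀) W₂ u y‖ ≤ Mu) →
      (∀ (y : TSite 3 (periodsT3 F K)) (μ : Fin 3), tdist (periodsT3 F K) x y ≤ 4 * (F.L : ℝ) ^ (K - n) + 1 →
        ‖WL2.equiv ℂ (fun _ : Bond 3 (periodsT3 F K) => c₀) W₂ f (y, μ)‖ ≤ Mf) →
      (∀ y, tdist (periodsT3 F K) x y ≤ 4 * (F.L : ℝ) ^ (K - n) + 1 → ‖WL2.equiv ℂ (fun _ : TSite 3 (periodsT3 F K) => c₀) W₂ q y‖ ≤ Mq) →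
      (∀ (y : TSite 3 (periodsT3 F K)) (μ : Fin 3), tdist (periodsT3 F K) x y ≤ 4 * (F.L : ℝ) ^ (K - n) + 1 →
        ‖((bgOfCfg F K V (y, μ) : (Matrix (Fin 2) (Fin 2) ℂ)ˣ) : Matrix (Fin 2) (Fin 2) ℂ) - 1‖ ≤ δ) →
      ∀ x' : TSite 3 (periodsT3 F K), tdist (periodsT3 F K) x x' ≤ (F.L : ℝ) ^ (K - n) →
        ‖WL2.equiv ℂ (fun _ : TSite 3 (periodsT3 F K) => c₀) W₂ u x' - WL2.equiv ℂ (fun _ : TSite 3 (periodsT3 F K) => c₀) W₂ u x‖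
          ≤ Ch * (Mu + Mf + Mq) * (tdist (periodsT3 F K) x x' / ((F.L : ℝ) ^ (K - n))) ^ ((1 : ℝ) / 2))
    (hεθ : ε₀ ≤ θ₀ / 48) {μ δ₁ : ℝ} (hμ : 0 < μ) (hμ1 : μ ≤ 1) (hδ₁ : 0 ≤ δ₁)
    (hδ : 3 * (Real.exp 1 * μ) ^ 2
        + a * ((25 / 8) * (c₁ * ((((F.P K).L : ℝ) ^ (F.P K).d) ^ (K - n))⁻¹ / c₀)) * (Real.exp (3 * μ) - 1) ^ 2 ≤ δ₁ ^ 2)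
    (hwin : Real.sqrt (max 2 (16 * c₀ * ((F.L : ℝ) ^ (K - n)) ^ 3 / (a * c₁))) * δ₁ ≤ 1 / 10) :
    ∀ (x : BondL2K ℂ 3 (periodsT3 F K) c₀ W₂) (X : ℝ), 0 ≤ X →
      (∀ b : Bond 3 (periodsT3 F K), ‖WL2.equiv ℂ (fun _ : Bond 3 (periodsT3 F K) => c₀) W₂ x b‖ ≤ X) →
      ∀ y : TSite 3 (periodsT3 F K), ‖WL2.equiv ℂ (fun _ : TSite 3 (periodsT3 F K) => c₀) W₂ (G (DstarL2 F n K c₀ U₀ x)) y‖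
        ≤ (2 * (8 * Ch * (1 + (a * ((5 / 4) * Real.sqrt (2 * c₁) * ((((F.P K).L : ℝ) ^ (F.P K).d) ^ (K - n))⁻¹ / c₀) *
              Real.sqrt ((25 / 8) * (c₁ * ((((F.P K).L : ℝ) ^ (F.P K).d) ^ (K - n))⁻¹ / c₀)) *
              Real.sqrt (c₀ * ((((F.P K).L : ℝ) ^ (F.P K).d) ^ (K - n))))) + 1) ^ 3
            * Real.sqrt (3 * Real.exp (12 * μ) * (2 * (1 + 1 / (2 * μ))) ^ 3
              * (32 * max 2 (16 * c₀ * ((F.L : ℝ) ^ (K - n)) ^ 3 / (a * c₁))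
                + 384 * Real.exp 1 ^ 2 * μ ^ 2 * (max 2 (16 * c₀ * ((F.L : ℝ) ^ (K - n)) ^ 3 / (a * c₁))) ^ 2)) + 1) * X := by
  intro x X hX hx
  have hc₀ : 0 < c₀ := Fact.out
  have hLpos : (0 : ℝ) < ((F.P K).L : ℝ) := by exact_mod_cast (F.P K).L_pos
  have hCpen : 0 ≤ a * ((5 / 4) * Real.sqrt (2 * c₁) * ((((F.P K).L : ℝ) ^ (F.P K).d) ^ (K - n))⁻¹ / c₀) *
      Real.sqrt ((25 / 8) * (c₁ * ((((F.P K).L : ℝ) ^ (F.P K).d) ^ (K - n))⁻¹ / c₀)) * Real.sqrt (c₀ * ((((F.P K).L : ℝ) ^ (F.P K).d) ^ (K - n))) := by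
    positivity
  have hCA : 0 ≤ 3 * Real.exp (12 * μ) * (2 * (1 + 1 / (2 * μ))) ^ 3
      * (32 * max 2 (16 * c₀ * ((F.L : ℝ) ^ (K - n)) ^ 3 / (a * c₁)) + 384 * Real.exp 1 ^ 2 * μ ^ 2 * (max 2 (16 * c₀ * ((F.L : ℝ) ^ (K - n)) ^ 3 / (a * c₁))) ^ 2) := by
    have hm : 0 ≤ max 2 (16 * c₀ * ((F.L : ℝ) ^ (K - n)) ^ 3 / (a * c₁)) := le_max_of_le_left (by norm_num)
    positivity
  exact sup_le_of_hHlocV_q Ch θ₀ hCh hH F n K c₀ hε₀.le hεθ U₀ hreg (G (DstarL2 F n K c₀ U₀ x)) ((a : ℂ) • T (ι (Q'' (G (DstarL2 F n K c₀ U₀ x))))) x X _ _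
    hX hCpen hCA (hAG _) hx (hPen_of_regPr F h hε₀ hε7 U₀ hreg Q'' hseq ι hι T hT ha (G (DstarL2 F n K c₀ U₀ x)))
    (fun y₀ => sq_sum_ball_G_DstarL2_le_kfree F h hε₀ hε7 U₀ hreg Q'' hseq ι hι T hT ha G hAG hμ hμ1 hδ₁ hδ hwin x hx y₀)

end LOD

end Summit.QuantumFields.YangMills.Theorems.Prop7LODDivergenceSupKnit

end
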